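import Summits.ABC.IUTFork.LDHSUnitFamilyValuations
import HarnessLib

/-!
# The S-unit quadratic family of the `λ`-line: IIb. The poles of `j(λ_{a,c})`: `ord_{𝔭₁} = −2a`, `ord_{𝔭₂} ≥ 0`,
# `ord_{𝔮₁} = ord_{𝔮₂} = −2c`, `≥ 0` elsewhere

Record-only PROOF file (D-0012) of the abc-iut cell (R2 S-chain team, seat abc-iut-s2-p4 gen 4); TAKES NO SIDE on [IUTchIII]
Cor. 3.12 or [IUTchIV] Thm. 1.10. S. Mochizuki, *IUT IV* [Mochizuki2012], Cor. 2.2 (ii) proof (P2), (P5) pp. 45–46; Dupuy–Hilado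
[DupuyHilado2025] §2.4.2, §3.3. Assembles part II's valuations of `θ, N₁, N₂` into `ord_v j(λ)` at every finite place of `F_{a,c}`
through `j(λ) = 2⁸N₂³/(θ²N₁²7^{2c})`: the pole divisor of `j(λ_{a,c})` is EXACTLY `2a·𝔭₁ + 2c·𝔮₁ + 2c·𝔮₂` and the prime `5` is
MIXED (`𝔭₂` good). Elementary; nothing asserted about Θ-data; no side taken.
[cite: Mochizuki2012, IUTchIV Cor 2.2 (ii) proof (P2) (P5) pp.45-46] [cite: DupuyHilado2025, §2.4.2, §3.3]
[claim: Mochizuki2012, status: disputed] for the IUT locators only.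
-/

noncomputable section

namespace Summit.ABC.IUTFork.SUnitFamily

open NumberField IsDedekindDomain Literature.IUT.LogVolume Literature.IUT.LogVolume.Cor22
open Literature.NumberTheory.DiophantineGeometry.GenEll

/-! ## `ord_v j(λ)` and `ord_v λ` at every finite place -/

section OrdJ

variable {a c : ℕ} {v : HeightOneSpectrum (𝓞 (F a c))}

/-- `5 ∤ s` when `a ≥ 1`, `7 ∤ s` when `c ≥ 1` (`s = 2·7^c + 5^a`). [folklore] -/
theorem not_dvd_s : (1 ≤ a → ¬ 5 ∣ s a c) ∧ (1 ≤ c → ¬ 7 ∣ s a c) := by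
  unfold s
  constructor
  · intro ha h
    have h5 : 5 ∣ 5 ^ a := dvd_pow_self 5 (by omega)
    have h2 : 5 ∣ 2 * 7 ^ c := (Nat.dvd_add_left h5).mp h
    have : 5 ∣ 7 ^ c := (Nat.Coprime.dvd_mul_left (by norm_num)).mp h2
    exact absurd (Nat.prime_five.dvd_of_dvd_pow this) (by norm_num)
  · intro hc h
    have h7 : 7 ∣ 2 * 7 ^ c := Dvd.dvd.mul_left (dvd_pow_self 7 (by omega)) 2
    have : 7 ∣ 5 ^ a := (Nat.dvd_add_right h7).mp h
    exact absurd ((Nat.prime_iff.mp (by norm_num : Nat.Prime 7)).dvd_of_dvd_pow this |> fun h => h) (by norm_num)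

/-- `N₂ ≠ 0` (it is a unit at the place `𝔮₂`; needs `c ≥ 1`). [folklore] -/
theorem N₂_ne_zero (hc : 1 ≤ c) : θ a c ^ 2 - (7 : F a c) ^ c * θ a c + (7 : F a c) ^ (2 * c) ≠ 0 := by
  haveI : Fact (Nat.Prime 7) := ⟨by norm_num⟩
  obtain ⟨𝔮₁, 𝔮₂, -, -, h₃, -, -, h7₂⟩ :=
    exists_places a c (p := 7) (Dvd.dvd.mul_left (dvd_pow_self 7 (by omega)) _) (not_dvd_s.2 hc)
  rw [← coe_N₂]
  exact coe_ne_zero_of_not_mem 𝔮₂ (N₂_not_mem_of_not_mem h7₂ h₃ hc)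

/-- **The valuation of `j(λ)` at any place**, in terms of those of `2, θ, N₁, N₂, 7`:
`ord_v j(λ) = 8·ord_v 2 + 3·ord_v N₂ − 2·ord_v θ − 2·ord_v N₁ − 2c·ord_v 7`. [cite: DupuyHilado2025, §2.4.2, §3.3] -/
theorem ord_jInv_lam (hc : 1 ≤ c) (v : HeightOneSpectrum (𝓞 (F a c))) :
    ord (F a c) v (jInv (lam a c)) = 8 * ord (F a c) v (2 : F a c)
      + 3 * ord (F a c) v (θ a c ^ 2 - (7 : F a c) ^ c * θ a c + (7 : F a c) ^ (2 * c))
      - 2 * ord (F a c) v (θ a c) - 2 * ord (F a c) v (θ a c - (7 : F a c) ^ c) - 2 * c * ord (F a c) v (7 : F a c) := by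
  have h2 : (2 : F a c) ^ 8 ≠ 0 := pow_ne_zero _ (by exact_mod_cast (show (2 : ℕ) ≠ 0 by norm_num))
  have h7 : (7 : F a c) ^ (2 * c) ≠ 0 := pow_ne_zero _ (by exact_mod_cast (show (7 : ℕ) ≠ 0 by norm_num))
  have hθ : θ a c ^ 2 ≠ 0 := pow_ne_zero _ (θ_ne_zero a c).1
  have hN₁ : (θ a c - (7 : F a c) ^ c) ^ 2 ≠ 0 := pow_ne_zero _ (N₁_ne_zero a c).1
  have hN₂ : (θ a c ^ 2 - (7 : F a c) ^ c * θ a c + (7 : F a c) ^ (2 * c)) ^ 3 ≠ 0 := pow_ne_zero _ (N₂_ne_zero hc)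
  rw [jInv_lam_eq, ord_div' v (mul_ne_zero h2 hN₂) (mul_ne_zero (mul_ne_zero hθ hN₁) h7),
    ord_mul (F a c) v h2 hN₂, ord_mul (F a c) v (mul_ne_zero hθ hN₁) h7, ord_mul (F a c) v hθ hN₁,
    ord_pow, ord_pow, ord_pow, ord_pow, ord_pow]
  push_cast; ring

/-- A place containing neither `5` nor `7` does not contain `θ`, nor `θ'`. [folklore] -/
theorem θ_not_mem_of (h5 : ((5 : ℕ) : 𝓞 (F a c)) ∉ v.asIdeal) (h7 : ((7 : ℕ) : 𝓞 (F a c)) ∉ v.asIdeal) :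
    θI a c ∉ v.asIdeal ∧ θI' a c ∉ v.asIdeal := by
  have hprod : θI a c * θI' a c ∉ v.asIdeal := by
    rw [θI_mul_θI']
    intro h
    push_cast at h
    rcases v.isPrime.mem_or_mem h with h' | h'
    · exact h5 (v.isPrime.mem_of_pow_mem _ h')
    · exact h7 (v.isPrime.mem_of_pow_mem _ h')
  exact ⟨fun h => hprod (v.asIdeal.mul_mem_right _ h), fun h => hprod (v.asIdeal.mul_mem_left _ h)⟩

/-- **`ord_v j(λ) ≥ 0` at every place dividing neither `5` nor `7`** (`c ≥ 1`). [cite: Mochizuki2012, IUTchIV Cor 2.2 (ii) proof (P2) p.45]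
[claim: Mochizuki2012, status: disputed] -/
theorem ord_jInv_nonneg_of_not_mem (hc : 1 ≤ c) (h5 : ((5 : ℕ) : 𝓞 (F a c)) ∉ v.asIdeal)
    (h7 : ((7 : ℕ) : 𝓞 (F a c)) ∉ v.asIdeal) : 0 ≤ ord (F a c) v (jInv (lam a c)) := by
  have ho7 : ord (F a c) v (7 : F a c) = 0 := by have := ord_natCast_eq_zero_of_not_mem v h7; simpa using this
  rw [ord_jInv_lam hc v, ord_θ_eq_zero (θ_not_mem_of h5 h7).1, ord_N₁_eq_zero (N₁_not_mem h7), ho7]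
  have h2 : 0 ≤ ord (F a c) v (2 : F a c) := by have := ord_natCast_nonneg v 2; simpa using this
  have hN₂ : 0 ≤ ord (F a c) v (θ a c ^ 2 - (7 : F a c) ^ c * θ a c + (7 : F a c) ^ (2 * c)) := ord_N₂_nonneg
  nlinarith

/-- **At `𝔭₁` (`5 ∈ v`, `θ ∈ v ∌ θ'`, `ord_v 5 = 1`): `ord_v j(λ) = −2a` and `ord_v λ = a`.**
[cite: Mochizuki2012, IUTchIV Cor 2.2 (ii) proof (P2) p.45] [claim: Mochizuki2012, status: disputed] -/
theorem ord_at_p1 (hc : 1 ≤ c) (h5 : ((5 : ℕ) : 𝓞 (F a c)) ∈ v.asIdeal) (hθ : θI a c ∈ v.asIdeal) (hθ' : θI' a c ∉ v.asIdeal)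
    (ho5 : ord (F a c) v (5 : F a c) = 1) :
    ord (F a c) v (jInv (lam a c)) = -(2 * a) ∧ ord (F a c) v (lam a c) = a := by
  haveI : Fact (Nat.Prime 5) := ⟨by norm_num⟩
  have hv : v ∈ placesOver (F a c) 5 := mem_placesOver_of_natCast_mem 5 v h5
  have h7 : ((7 : ℕ) : 𝓞 (F a c)) ∉ v.asIdeal := SplitDepth.natCast_not_mem_of_prime_ne ⟨v, hv⟩ (by norm_num) (by norm_num)
  have h2 : ((2 : ℕ) : 𝓞 (F a c)) ∉ v.asIdeal := SplitDepth.natCast_not_mem_of_prime_ne ⟨v, hv⟩ (by norm_num) (by norm_num)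
  have ho7 : ord (F a c) v (7 : F a c) = 0 := by have := ord_natCast_eq_zero_of_not_mem v h7; simpa using this
  have ho2 : ord (F a c) v (2 : F a c) = 0 := by have := ord_natCast_eq_zero_of_not_mem v h2; simpa using this
  have hoθ : ord (F a c) v (θ a c) = a := by rw [ord_θ_of_not_mem hθ', ho5, ho7]; ring
  refine ⟨?_, ?_⟩
  · rw [ord_jInv_lam hc v, ho2, ord_N₂_eq_zero (N₂_not_mem_of_mem hθ h7), hoθ, ord_N₁_eq_zero (N₁_not_mem h7), ho7]; ring
  · unfold lam
    rw [ord_div' v (θ_ne_zero a c).1 (pow_ne_zero _ (by exact_mod_cast (show (7 : ℕ) ≠ 0 by norm_num))), ord_pow, hoθ, ho7]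
    ring

/-- **At `𝔭₂` (`5 ∈ v ∌ θ`): `ord_v j(λ) ≥ 0` (the GOOD place over the MIXED prime `5`) and `ord_v λ = 0`.**
[cite: Mochizuki2012, IUTchIV Cor 2.2 (ii) proof (P5) p.46] [claim: Mochizuki2012, status: disputed] -/
theorem ord_at_p2 (hc : 1 ≤ c) (h5 : ((5 : ℕ) : 𝓞 (F a c)) ∈ v.asIdeal) (hθ : θI a c ∉ v.asIdeal) :
    0 ≤ ord (F a c) v (jInv (lam a c)) ∧ ord (F a c) v (lam a c) = 0 := by
  haveI : Fact (Nat.Prime 5) := ⟨by norm_num⟩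
  have hv : v ∈ placesOver (F a c) 5 := mem_placesOver_of_natCast_mem 5 v h5
  have h7 : ((7 : ℕ) : 𝓞 (F a c)) ∉ v.asIdeal := SplitDepth.natCast_not_mem_of_prime_ne ⟨v, hv⟩ (by norm_num) (by norm_num)
  have h2 : ((2 : ℕ) : 𝓞 (F a c)) ∉ v.asIdeal := SplitDepth.natCast_not_mem_of_prime_ne ⟨v, hv⟩ (by norm_num) (by norm_num)
  have ho7 : ord (F a c) v (7 : F a c) = 0 := by have := ord_natCast_eq_zero_of_not_mem v h7; simpa using this
  have ho2 : ord (F a c) v (2 : F a c) = 0 := by have := ord_natCast_eq_zero_of_not_mem v h2; simpa using this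
  have hoθ : ord (F a c) v (θ a c) = 0 := ord_θ_eq_zero hθ
  refine ⟨?_, ?_⟩
  · rw [ord_jInv_lam hc v, ho2, hoθ, ord_N₁_eq_zero (N₁_not_mem h7), ho7]
    have hN₂ : 0 ≤ ord (F a c) v (θ a c ^ 2 - (7 : F a c) ^ c * θ a c + (7 : F a c) ^ (2 * c)) := ord_N₂_nonneg
    nlinarith
  · unfold lam
    rw [ord_div' v (θ_ne_zero a c).1 (pow_ne_zero _ (by exact_mod_cast (show (7 : ℕ) ≠ 0 by norm_num))), ord_pow, hoθ, ho7]
    ring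

/-- **At `𝔮₁` (`7 ∈ v`, `θ ∈ v ∌ θ'`, `ord_v 7 = 1`, `c ≥ 1`): `ord_v j(λ) = −2c`.**
[cite: Mochizuki2012, IUTchIV Cor 2.2 (ii) proof (P2) p.45] [claim: Mochizuki2012, status: disputed] -/
theorem ord_at_q1 (hc : 1 ≤ c) (h7 : ((7 : ℕ) : 𝓞 (F a c)) ∈ v.asIdeal) (hθ' : θI' a c ∉ v.asIdeal)
    (ho7 : ord (F a c) v (7 : F a c) = 1) : ord (F a c) v (jInv (lam a c)) = -(2 * c) := by
  haveI : Fact (Nat.Prime 7) := ⟨by norm_num⟩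
  have hv : v ∈ placesOver (F a c) 7 := mem_placesOver_of_natCast_mem 7 v h7
  have h5 : ((5 : ℕ) : 𝓞 (F a c)) ∉ v.asIdeal := SplitDepth.natCast_not_mem_of_prime_ne ⟨v, hv⟩ (by norm_num) (by norm_num)
  have h2 : ((2 : ℕ) : 𝓞 (F a c)) ∉ v.asIdeal := SplitDepth.natCast_not_mem_of_prime_ne ⟨v, hv⟩ (by norm_num) (by norm_num)
  have ho5 : ord (F a c) v (5 : F a c) = 0 := by have := ord_natCast_eq_zero_of_not_mem v h5; simpa using this
  have ho2 : ord (F a c) v (2 : F a c) = 0 := by have := ord_natCast_eq_zero_of_not_mem v h2; simpa using this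
  have hoθ : ord (F a c) v (θ a c) = c := by rw [ord_θ_of_not_mem hθ', ho5, ho7]; ring
  rw [ord_jInv_lam hc v, ho2, ord_N₂_eq h7 hθ' ho7 hc, hoθ, ord_N₁_eq h7 hθ' ho7 hc, ho7]; ring

/-- **At `𝔮₂` (`7 ∈ v ∌ θ`, `ord_v 7 = 1`, `c ≥ 1`): `ord_v j(λ) = −2c`.**
[cite: Mochizuki2012, IUTchIV Cor 2.2 (ii) proof (P2) p.45] [claim: Mochizuki2012, status: disputed] -/
theorem ord_at_q2 (hc : 1 ≤ c) (h7 : ((7 : ℕ) : 𝓞 (F a c)) ∈ v.asIdeal) (hθ : θI a c ∉ v.asIdeal)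
    (ho7 : ord (F a c) v (7 : F a c) = 1) : ord (F a c) v (jInv (lam a c)) = -(2 * c) := by
  haveI : Fact (Nat.Prime 7) := ⟨by norm_num⟩
  have hv : v ∈ placesOver (F a c) 7 := mem_placesOver_of_natCast_mem 7 v h7
  have h2 : ((2 : ℕ) : 𝓞 (F a c)) ∉ v.asIdeal := SplitDepth.natCast_not_mem_of_prime_ne ⟨v, hv⟩ (by norm_num) (by norm_num)
  have ho2 : ord (F a c) v (2 : F a c) = 0 := by have := ord_natCast_eq_zero_of_not_mem v h2; simpa using this
  rw [ord_jInv_lam hc v, ho2, ord_θ_eq_zero hθ, ord_N₁_eq_zero (N₁_not_mem' h7 hθ hc),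
    ord_N₂_eq_zero (N₂_not_mem_of_not_mem h7 hθ hc), ho7]; ring

/-- **The poles of `j(λ)` lie over `5` or `7`**: if `ord_v j(λ) < 0` then `5 ∈ v` or `7 ∈ v` (`c ≥ 1`).
[cite: Mochizuki2012, IUTchIV Cor 2.2 (ii) proof (P2) p.45] [claim: Mochizuki2012, status: disputed] -/
theorem five_mem_or_seven_mem_of_ord_neg (hc : 1 ≤ c) (hv : ord (F a c) v (jInv (lam a c)) < 0) :
    ((5 : ℕ) : 𝓞 (F a c)) ∈ v.asIdeal ∨ ((7 : ℕ) : 𝓞 (F a c)) ∈ v.asIdeal := by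
  by_contra h
  push Not at h
  exact absurd (ord_jInv_nonneg_of_not_mem hc h.1 h.2) (not_le.mpr hv)

end OrdJ

end Summit.ABC.IUTFork.SUnitFamily

end
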